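import Literature.MathematicalPhysics.PowerSystems.LineOutageAlgebraicConnectivity
import HarnessLib

/-!
# DC power flow under a single line outage, II: the maximum principle for transfer potentials,
# `|LODF| ≤ 1` by flow conservation across a level cut, the LODF from resistance distances alone
# (Soltan–Mazauric–Zussman Lemma 5), the resistance-distance bound (Cor. 2), and «bridge ⟺
# b_rs·𝓡(r ↔ s) = 1» (Bapat / Guo et al. Cor. 5) as an iff with the edge-deleted graph

Topic `Literature/MathematicalPhysics/PowerSystems`; namespaces `…PowerSystems.KronReduction`
(§1–§4, network statements) and `…PowerSystems.ClassicalModel` (§5, the DC power-flow model).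
Third file of the DC line-outage story: `DCFlowLineOutageFactor.lean` (transfer potentials `L v =
e_a − e_b`, `𝓡(a ↔ b) = v_a − v_b`, reciprocity, the self-factor `b_rs𝓡 ≤ 1` / `< 1` / `= 1`, the
LODF identity `dcFlow_lineOutage_flowChange(_div)`), `LineOutageAlgebraicConnectivity.lean`.  Tree
tools BY NAME: `Literature/Probability/MarkovChains/EffectiveResistance.lean` [LevinPeres2017 §9]
(`unitVoltage_spec/_nonneg/_le_one` — the maximum principle of Prop. 9.1, `isUnitFlow_unitCurrentFlow`,
`flowDiv_unitCurrentFlow_source`, `LevinPeres2017_lemma_9_15_eq` — strength = net flow across a cut),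
`CommuteTimeIdentity.lean` (`effectiveResistance_self`), Mathlib's `SimpleGraph.deleteEdges`.
Everything below is PROVED: 0 definitions, 0 named facts, 0 `sorry`, no new axiom.

SOURCES (read on the page).
* [SoltanMazauricZussman2014] S. Soltan, D. Mazauric, G. Zussman, *Cascading failures in power grids
  — analysis and algorithms*, ACM e-Energy 2014, 195–206 (`lit galaxy read pdf:4531151893895507580`;
  page labels of that text).  §3 (p0005 L9–L18): the DC model, `Σ_{v∈N(u)} f_uv = p_u`, `θ_u − θ_v =
  x_uv f_uv`.  §4 Lemma 1 (p0008 L23): «LEMMA 1 (BAPAT [8]). … an edge `{i,j} ∈ E` is a cut-edge if,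
  and only if, `a_ij⁻¹ − 2a⁺_ij + a⁺_ii + a⁺_jj = 0`» (`A` the admittance Laplacian, `a_ij = −1/x_ij`:
  i.e. `r(i,j) = x_ij`, self-factor one).  Theorem 1 (p0009 L7–L11): rank-one update of `A⁺` «if
  `{i,j}` is not a cut-edge»; Corollary 1 (p0009 L21–L23): «`f'_rs = f_rs − (a_rs/a_ij)·[(a⁺_ri −
  a⁺_rj) − (a⁺_si − a⁺_sj)]/[a_ij⁻¹ − 2a⁺_ij + a⁺_ii + a⁺_jj]·f_ij`».  §5 Definition 1 (p0009 L31):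
  «`r(i,j) := a⁺_ii + a⁺_jj − 2a⁺_ij`»; Lemma 5 (p0011 L23–L27): «the flow change … for an edge `e =
  {i,j}` after a failure in a non-cut-edge `e' = {p,q}`: `Δf_ij = ½·(−r(i,p) + r(i,q) + r(j,p) −
  r(j,q))/(1 − r(p,q))·f_pq`» (unit reactances `x = 1`, p0011 L11); Corollary 2 (p0011 L29–L31, p0012
  L1): «`|Δf_ij| ≤ r(p,q)/(1 − r(p,q))·|f_pq|`» («by using the triangle inequality for resistance
  distance and Lemma 5»).
* [GuoEtAl2020] L. Guo, C. Liang, A. Zocca, S. H. Low, A. Wierman, *Line failure localization of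
  power networks, Part I: non-cut outages*, IEEE TPWRS 2021, arXiv:2005.10199.  §3.2 Corollary 5
  (p0008 L6–L21): «`D = BCᵀAC` … `D_ll = 1 − Σ_{F∈T_{−l}}β(F)/Σ_{F∈T_E}β(F)`.  Hence, `D_ll = 1` if `l`
  is a bridge and `0 < D_ll < 1` otherwise»; §3.3.1 (p0008 L40–L54): «`K_{l l̂} = B_l(A_{iî} + A_{jĵ}
  − A_{iĵ} − A_{jî})/(1 − B_l̂(A_{îî} + A_{ĵĵ} − A_{îĵ} − A_{ĵî})) = D_{l l̂}/(1 − D_{l̂ l̂})` … This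
  formula only holds if the post-contingency graph `G' := (N, E∖{l̂})` is connected, as otherwise its
  denominator is `0` by Corollary 5».
* [LevinPeres2017] §9.2 Prop. 9.1 (harmonic extension: maximum principle), §9.4 proof of Lemma 9.15
  (strength = net flow across any cut separating source and sink) — tree, by name.
* [KirklandNeumann2012] §7.4 (7.13) `r(i,j) = l#_ii + l#_jj − 2l#_ij` (held text p0183); Theorem 7.4.9
  (p0186): `r(i,j) ≤ δ̃(i,j)` «Equality holds … if and only if there is a unique path».

RENDERING.  As in `DCFlowLineOutageFactor`: conductance network `c` (`IsConductance c`), `L =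
diagonal (nodeConductance c) − c`, graph hypothesis `G.Adj x y ↔ x ≠ y ∧ c x y ≠ 0`, connected;
transfer potentials `L *ᵥ v = Pi.single p 1 − Pi.single q 1`; the outage of `{p,q}` as `hL' : L' = L
− c p q • vecMulVec ν_pq ν_pq`; «`p, q` still joined» = reachable in a graph `G'` of lines other than
`{p,q}`; the bridge dichotomy of §4 uses `G.deleteEdges {s(p, q)}` itself.  The source's pseudo-inverse
entries `a⁺`, `A` never appear: differences of transfer potentials and the tree's `𝓡` replace them.

WHAT IS PROVED (0 `def`, 0 named facts, 0 `sorry`).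
* §1 ★ `resistance_mul_unitVoltage_transferPotential` (`W = 𝓡·W₁` solves `LW = e_p − e_q`, `W(p) =
  𝓡`, `W(q) = 0`, `0 ≤ W ≤ 𝓡`); ★★ **`transferPotential_mem_Icc`** (MAXIMUM PRINCIPLE: every transfer
  potential has `v_q ≤ v_i ≤ v_p`, `v_p − v_q = 𝓡(p ↔ q)`, `|v_i − v_j| ≤ 𝓡(p ↔ q)` — so `|PTDF_(ij),pq|
  ≤ b_ij𝓡(p ↔ q)`).
* §2 ★★★ **`conductance_mul_transferPotential_sub_le`** (`c(m,n)|v_m − v_n| ≤ 1 − c(p,q)𝓡(p ↔ q)` for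
  every ordered pair other than `(p,q),(q,p)` — DERIVED: the unit current flow crosses the level cut
  `{W ≥ W_m} ∋ p`, `∌ q` only downhill, so the two downhill line flows `(m,n)` and `(p,q)` sum to at
  most the strength `1`).
* §3 ★ `transferPotential_sub_source_eq`, ★★ **`transferPotential_sub_eq_resistances`**
  (POLARIZATION: `v_i − v_j = ½(𝓡(i ↔ q) − 𝓡(i ↔ p) + 𝓡(j ↔ p) − 𝓡(j ↔ q))` — Lemma 5's numerator).
* §4 ★★★ **`conductance_mul_effectiveResistance_lt_one_iff_reachable`** (BAPAT / Cor. 5 as an iff: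
  `c(r,s)𝓡(r ↔ s) < 1 ↔ (G.deleteEdges {s(r,s)}).Reachable r s` and `= 1 ↔ ¬ …`).
* §5 THE MODEL: ★★★ **`dcFlow_lineOutage_flowChange_resistances`** (LEMMA 5 weighted, division-free:
  `(1 − b_pq𝓡_pq)·ΔF_{i→j} = b_ij·½(𝓡_iq − 𝓡_ip + 𝓡_jp − 𝓡_jq)·F_{p→q}`), ★★★
  **`dcFlow_lineOutage_flowChange_abs_le`** (non-bridge outage: `|ΔF_{m→n}| ≤ |F_{p→q}|` — `|LODF| ≤
  1`, DERIVED —, COROLLARY 2 weighted `|ΔF_{m→n}| ≤ b_mn𝓡_pq/(1 − b_pq𝓡_pq)·|F_{p→q}|`, and the N−1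
  loading screen `|F'_{m→n}| ≤ |F_{m→n}| + |F_{p→q}|`).

PROOF ROUTE.  §1: node law off `{p,q}`, unit strength at `p`, `−1` at the sink, and `0 ≤ W₁ ≤ 1`
(Prop. 9.1); any other transfer potential differs by a constant (`laplacian_mulVec_eq_mulVec_iff`).
§2: for `W_n < W_m` take `S = {x : W_m ≤ W_x}`; `p ∈ S` (`W ≤ 𝓡 = W_p`), `q ∉ S` (`W_q = 0 < W_m`);
Lemma 9.15's identity `1 = Σ_{S×Sᶜ} I(x,y)` with every term `c(x,y)(W_x − W_y) ≥ 0`, and the two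
terms `(m,n)`, `(p,q)` are distinct members of `S × Sᶜ`.  §3: `u^{ab} + u^{ia}` is a transfer
potential for `(i,b)`; expand `𝓡(i ↔ b)`, `𝓡(i ↔ a)`, `𝓡(a ↔ b)` as potential drops and use
reciprocity; subtract at `i` and `j`.  §4: `deleteEdges_adj` + `Sym2.eq_iff` make the deleted graph
a «graph of other lines» for `…_lt_one`; conversely the `deleteEdges`-reachable set of `r` is a cut
crossed only by `{r,s}` for `…_eq_one_of_bridge`.  §5: `dcFlow_lineOutage_flowChange(_div)` of the
first file with §3 / §1 / §2.  In-seat exact cross-check (`negtest/dcflow_bounds_check.py`, python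
`Fraction`s): 40 random connected networks (3–7 nodes), every line as the outage, all ordered pairs:
maximum principle, both polarization identities against independently solved resistances, the
level-cut bound, bridge ⟺ `c𝓡 = 1` against graph search, Lemma 5 / `|LODF| ≤ 1` / Cor. 2 / the
loading screen against DIRECT post-outage solves — 50 233 checks, 0 failures.

THREE COLUMNS.  CERTIFIED (kernel theorems, exact data): maximum principle and `|v_i − v_j| ≤ 𝓡`;
the level-cut bound `c(m,n)|v_m − v_n| ≤ 1 − c(p,q)𝓡(p ↔ q)`; polarization; bridge ⟺ self-factor
one; for the DC model after a non-bridge outage: LODF from resistances, `|ΔF_{m→n}| ≤ |F_{p→q}|`,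
Cor. 2's bound, `|F'| ≤ |F| + |F_pq|`.  MODELLED: DC (linearised, lossless, flat-voltage) power flow
with fixed injections; single outage; no limits, protection, re-dispatch or dynamics.  VALIDATED:
nothing numerical in Lean.  PRINT vs TYPED: Lemma 1 / Cor. 5 / Lemma 5 / Cor. 2 are typed as printed
(weighted form; Soltan et al. print unit reactances); `|LODF| ≤ 1` and the level-cut bound are
DERIVED here from Levin–Peres's cut identity and maximum principle — no printed statement of them is
quoted (the printed Cor. 2 is weaker whenever `b_mn𝓡_pq > 1 − b_pq𝓡_pq`).  NOT CLAIMED: Soltan et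
al. Theorem 1 (the `A⁺` update itself), Cor. 3 (edge-to-edge resistance distance), §6–§8
(cascades, yield, algorithms), multi-line outages, AC flow.

## References
* [SoltanMazauricZussman2014] S. Soltan, D. Mazauric, G. Zussman, *Cascading failures in power
  grids: analysis and algorithms*, Proc. ACM e-Energy 2014, 195–206, doi:10.1145/2602044.2602066 —
  §3, §4 Lemma 1, Theorem 1, Corollary 1, §5 Definition 1, Lemma 5, Corollary 2.
* [GuoEtAl2020] L. Guo, C. Liang, A. Zocca, S. H. Low, A. Wierman, *Line Failure Localization of
  Power Networks Part I: Non-cut Outages*, IEEE TPWRS 36 (2021), arXiv:2005.10199 — §3.2 Cor. 5,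
  §3.3.1.
* [LevinPeres2017] D. A. Levin, Y. Peres, *Markov Chains and Mixing Times*, 2nd ed., AMS 2017 —
  §9.2 Prop. 9.1, §9.3–9.4 (unit current flow, Lemma 9.15).
* [KirklandNeumann2012] S. J. Kirkland, M. Neumann, *Group Inverses of M-Matrices and Their
  Applications*, CRC 2012 — §7.4 (7.13), Theorem 7.4.9.
* [StrakeEtAl2019] J. Strake et al., *Non-local impact of link failures in linear flow networks*,
  New J. Phys. 21 (2019) 053009, arXiv:1811.08683 — §3.2 eq. (10).
* [SpielmanSrivastava2011] D. A. Spielman, N. Srivastava, SIAM J. Comput. 40 (2011), arXiv:0803.0929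
  — §2.2 (unit current across an edge, potentials `L†b_e`).
-/

noncomputable section

open scoped Matrix
open Finset Matrix

namespace Literature.MathematicalPhysics.PowerSystems

namespace KronReduction

open Literature.Probability.MarkovChains

variable {X : Type*} [Fintype X] [DecidableEq X] {c : Matrix X X ℝ}

/-! ### §1. The voltage of the unit transfer: `L(𝓡·W₁) = e_p − e_q`, all transfer potentials lie
between their values at `q` and `p`, `|v_i − v_j| ≤ 𝓡(p ↔ q)` -/

section MaximumPrinciple

/-- `(L v)_x = Σ_y c(x,y)(v_x − v_y)`. [folklore] -/
private theorem laplacian_mulVec₁₄ (c : Matrix X X ℝ) (v : X → ℝ) (x : X) :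
    ((Matrix.diagonal (nodeConductance c) - c) *ᵥ v) x = ∑ y, c x y * (v x - v y) := by
  rw [Matrix.sub_mulVec, Pi.sub_apply, Matrix.mulVec_diagonal, nodeConductance_def, Matrix.mulVec,
    dotProduct, Finset.sum_mul, ← Finset.sum_sub_distrib]
  exact Finset.sum_congr rfl fun y _ => by ring

/-- The divergence of the current flow of `v` is `L v`. [folklore] -/
private theorem flowDiv_currentFlow_eq₁₄ (c : Matrix X X ℝ) (v : X → ℝ) (x : X) :
    flowDiv (currentFlow c v) x = ((Matrix.diagonal (nodeConductance c) - c) *ᵥ v) x := by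
  rw [laplacian_mulVec₁₄, flowDiv_def]
  rfl

/-- ★ **THE VOLTAGE OF THE UNIT CURRENT FLOW IS A TRANSFER POTENTIAL**: `W = 𝓡(p ↔ q)·W₁` (unit
voltage `W₁`, `W₁(p) = 1`, `W₁(q) = 0`) satisfies `L W = e_p − e_q`, `W(p) = 𝓡(p ↔ q)`, `W(q) = 0` and
`0 ≤ W ≤ 𝓡(p ↔ q)` (maximum principle).
[cite: LevinPeres2017, §9.3 (the voltage with `W(z) = 0` is determined by `W(a)`; unit current flow), §9.2 Prop. 9.1 (maximum principle, `0 ≤ W₁ ≤ 1`); SpielmanSrivastava2011, §2.2 (arXiv:0803.0929 p0005 L80–L91)] -/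
theorem resistance_mul_unitVoltage_transferPotential (hc : IsConductance c) {G : SimpleGraph X}
    (hG : ∀ x y, G.Adj x y ↔ x ≠ y ∧ c x y ≠ 0) (hconn : G.Connected) {p q : X} (hpq : p ≠ q) :
    (Matrix.diagonal (nodeConductance c) - c) *ᵥ (fun x => effectiveResistance c p q * unitVoltage c p q x)
        = Pi.single p 1 - Pi.single q 1
    ∧ effectiveResistance c p q * unitVoltage c p q p = effectiveResistance c p q
    ∧ effectiveResistance c p q * unitVoltage c p q q = 0
    ∧ ∀ x, 0 ≤ effectiveResistance c p q * unitVoltage c p q x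
      ∧ effectiveResistance c p q * unitVoltage c p q x ≤ effectiveResistance c p q := by
  classical
  have hirr := isIrreducible_networkKernel_of_connected hc hG hconn
  have hW := isVoltage_resistance_mul_unitVoltage hc hirr hpq
  have hunit := isUnitFlow_unitCurrentFlow hc hirr hpq
  obtain ⟨-, hp1, hq0⟩ := unitVoltage_spec hc hirr hpq
  have hRpos := effectiveResistance_pos hc hirr hpq
  refine ⟨funext fun x => ?_, by rw [hp1, mul_one], by rw [hq0, mul_zero], fun x => ⟨?_, ?_⟩⟩
  · rw [← flowDiv_currentFlow_eq₁₄, Pi.sub_apply]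
    have hcur : currentFlow c (fun x => effectiveResistance c p q * unitVoltage c p q x)
        = unitCurrentFlow c p q := rfl
    by_cases hxp : x = p
    · rw [hxp, hcur, flowDiv_unitCurrentFlow_source hc hirr hpq, Pi.single_eq_same,
        Pi.single_eq_of_ne hpq, sub_zero]
    by_cases hxq : x = q
    · rw [hxq, hcur, hunit.flowDiv_sink hpq, Pi.single_eq_same, Pi.single_eq_of_ne (Ne.symm hpq),
        zero_sub]
    · rw [hW.flowDiv_currentFlow_eq_zero hc hxp hxq, Pi.single_eq_of_ne hxp, Pi.single_eq_of_ne hxq,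
        sub_zero]
  · exact mul_nonneg hRpos.le (unitVoltage_nonneg hc hirr hpq x)
  · exact (mul_le_mul_of_nonneg_left (unitVoltage_le_one hc hirr hpq x) hRpos.le).trans_eq (mul_one _)

/-- ★★ **MAXIMUM PRINCIPLE FOR TRANSFER POTENTIALS**: if `L v = e_p − e_q` (`p ≠ q`) on a connected
network then `v_q ≤ v_i ≤ v_p` for every node `i` and `|v_i − v_j| ≤ v_p − v_q = 𝓡(p ↔ q)` for all
`i, j` — so every PTDF satisfies `|PTDF_(i,j),p,q| = b_ij|v_i − v_j| ≤ b_ij·𝓡(p ↔ q)` (the weighted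
form of «`M_{e,e'} ≤ r(p,q)/(1 − r(p,q))`» before dividing by the LODF denominator).
[cite: LevinPeres2017, §9.2 Prop. 9.1 (maximum principle for harmonic functions); SoltanMazauricZussman2014, §5 Corollary 2 (galaxy-pdf p0011 L29–L31, p0012 L1)] -/
theorem transferPotential_mem_Icc (hc : IsConductance c) {G : SimpleGraph X}
    (hG : ∀ x y, G.Adj x y ↔ x ≠ y ∧ c x y ≠ 0) (hconn : G.Connected) {p q : X} (hpq : p ≠ q)
    {v : X → ℝ} (hv : (Matrix.diagonal (nodeConductance c) - c) *ᵥ v = Pi.single p 1 - Pi.single q 1) :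
    (∀ i, v q ≤ v i ∧ v i ≤ v p) ∧ (v p - v q = effectiveResistance c p q)
    ∧ ∀ i j, |v i - v j| ≤ effectiveResistance c p q := by
  obtain ⟨hLW, hWp, hWq, hWb⟩ := resistance_mul_unitVoltage_transferPotential hc hG hconn hpq
  obtain ⟨κ, hκ⟩ := (laplacian_mulVec_eq_mulVec_iff hc hG hconn _ _).1 (hLW.trans hv.symm)
  have hvx : ∀ x, v x = effectiveResistance c p q * unitVoltage c p q x + κ := hκ
  refine ⟨fun i => ⟨?_, ?_⟩, ?_, fun i j => ?_⟩
  · rw [hvx q, hvx i, hWq]; linarith [(hWb i).1]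
  · rw [hvx i, hvx p, hWp]; linarith [(hWb i).2]
  · rw [hvx p, hvx q, hWp, hWq]; ring
  · rw [hvx i, hvx j, abs_le]
    constructor <;> linarith [(hWb i).1, (hWb i).2, (hWb j).1, (hWb j).2]

end MaximumPrinciple

/-! ### §2. Flow conservation across a level cut: every line other than `{p,q}` carries at most
`1 − c(p,q)𝓡(p ↔ q)` of the unit transfer -/

section LevelCut

/-- One-sided level-cut bound: if `W = 𝓡·W₁` and `W n < W m` then
`c(m,n)(W m − W n) + c(p,q)𝓡 ≤ 1` unless `(m,n) = (p,q)`. [folklore] -/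
private theorem levelCut_bound₁₄ (hc : IsConductance c) {G : SimpleGraph X}
    (hG : ∀ x y, G.Adj x y ↔ x ≠ y ∧ c x y ≠ 0) (hconn : G.Connected) {p q : X} (hpq : p ≠ q)
    {m n : X} (hmn : ¬ (m = p ∧ n = q))
    (hlt : effectiveResistance c p q * unitVoltage c p q n < effectiveResistance c p q * unitVoltage c p q m) :
    c m n * (effectiveResistance c p q * unitVoltage c p q m - effectiveResistance c p q * unitVoltage c p q n)
      + c p q * effectiveResistance c p q ≤ 1 := by
  classical
  have hirr := isIrreducible_networkKernel_of_connected hc hG hconn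
  obtain ⟨-, hWp, hWq, hWb⟩ := resistance_mul_unitVoltage_transferPotential hc hG hconn hpq
  set W : X → ℝ := fun x => effectiveResistance c p q * unitVoltage c p q x with hWdef
  have hunit := isUnitFlow_unitCurrentFlow hc hirr hpq
  have hθ : ∀ x y, unitCurrentFlow c p q x y = c x y * (W x - W y) := fun x y => rfl
  -- the level cut `S = {W ≥ W m}` contains `p` and not `q`
  set S : Finset X := Finset.univ.filter (fun x => W m ≤ W x) with hS
  have hmS : m ∈ S := by simp [hS]
  have hpS : p ∈ S := by
    simp only [hS, Finset.mem_filter, Finset.mem_univ, true_and]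
    rw [show W p = effectiveResistance c p q from hWp]; exact (hWb m).2
  have hWm_pos : 0 < W m := lt_of_le_of_lt (hWb n).1 hlt
  have hqS : q ∉ S := by
    simp only [hS, Finset.mem_filter, Finset.mem_univ, true_and, not_le]
    change W q < W m
    rw [show W q = 0 from hWq]; exact hWm_pos
  have hnS : n ∈ Sᶜ := by
    rw [Finset.mem_compl]; simp only [hS, Finset.mem_filter, Finset.mem_univ, true_and, not_le]; exact hlt
  have hqS' : q ∈ Sᶜ := Finset.mem_compl.2 hqS
  -- unit strength = net flow across the cut, all terms non-negative
  have hcut := LevinPeres2017_lemma_9_15_eq hunit.1.1 hunit.2.1 hpS hqS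
  rw [flowDiv_unitCurrentFlow_source hc hirr hpq, ← Finset.sum_product'] at hcut
  have hnn : ∀ e ∈ S ×ˢ Sᶜ, 0 ≤ unitCurrentFlow c p q e.1 e.2 := by
    intro e he
    rw [Finset.mem_product] at he
    have h1 : W m ≤ W e.1 := by simpa [hS] using he.1
    have h2 : W e.2 < W m := by
      have := he.2; rw [Finset.mem_compl] at this; simpa [hS] using this
    rw [hθ]
    exact mul_nonneg (hc.nonneg _ _) (by linarith)
  have hpair : ((m, n) : X × X) ≠ (p, q) := fun h => hmn ⟨(Prod.mk.inj h).1, (Prod.mk.inj h).2⟩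
  have hsub : ({(m, n), (p, q)} : Finset (X × X)) ⊆ S ×ˢ Sᶜ := by
    intro e he
    rw [Finset.mem_insert, Finset.mem_singleton] at he
    rcases he with rfl | rfl
    · exact Finset.mem_product.2 ⟨hmS, hnS⟩
    · exact Finset.mem_product.2 ⟨hpS, hqS'⟩
  have hle := Finset.sum_le_sum_of_subset_of_nonneg hsub (fun e he _ => hnn e he)
  rw [Finset.sum_pair hpair] at hle
  dsimp only at hle
  have hWp' : W p = effectiveResistance c p q := hWp
  have hWq' : W q = 0 := hWq
  rw [← hcut, hθ, hθ, hWp', hWq', sub_zero] at hle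
  exact hle

/-- ★★★ **NO OTHER LINE CARRIES MORE THAN `1 − c(p,q)𝓡(p ↔ q)` OF A UNIT TRANSFER FROM `p` TO
`q`**: for every transfer potential (`L v = e_p − e_q`, `p ≠ q`) and every ordered pair `(m,n)` other
than `(p,q)` and `(q,p)`: `c(m,n)·|v_m − v_n| ≤ 1 − c(p,q)·𝓡(p ↔ q)` — i.e. `|PTDF_(m,n),p,q| ≤ 1 −
PTDF_(p,q),p,q`, hence `|LODF_(mn),(pq)| ≤ 1`.  DERIVED HERE (flow conservation of the unit current
flow across the level cut `{W ≥ W_m}`, which always contains `p`, never `q`, and carries only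
downhill — non-negative — line flows including the direct line's `c(p,q)𝓡`); the printed weaker
bound is «`|Δf_ij| ≤ r(p,q)/(1 − r(p,q))·|f_pq|`».
[cite: LevinPeres2017, §9.4 Lemma 9.15 (proof: strength = net flow across a cut) with §9.2 Prop. 9.1 (maximum principle); SoltanMazauricZussman2014, §5 Corollary 2 (galaxy-pdf p0011 L29–L31, p0012 L1); GuoEtAl2020, §3.2 Corollary 5 («`0 < D_ll < 1`», arXiv:2005.10199 p0008 L6–L21)] -/
theorem conductance_mul_transferPotential_sub_le (hc : IsConductance c) {G : SimpleGraph X}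
    (hG : ∀ x y, G.Adj x y ↔ x ≠ y ∧ c x y ≠ 0) (hconn : G.Connected) {p q : X} (hpq : p ≠ q)
    {v : X → ℝ} (hv : (Matrix.diagonal (nodeConductance c) - c) *ᵥ v = Pi.single p 1 - Pi.single q 1)
    {m n : X} (h1 : ¬ (m = p ∧ n = q)) (h2 : ¬ (m = q ∧ n = p)) :
    c m n * |v m - v n| ≤ 1 - c p q * effectiveResistance c p q := by
  obtain ⟨hLW, hWp, hWq, hWb⟩ := resistance_mul_unitVoltage_transferPotential hc hG hconn hpq
  obtain ⟨κ, hκ⟩ := (laplacian_mulVec_eq_mulVec_iff hc hG hconn _ _).1 (hLW.trans hv.symm)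
  have hvmn : v m - v n = effectiveResistance c p q * unitVoltage c p q m
      - effectiveResistance c p q * unitVoltage c p q n := by rw [hκ m, hκ n]; ring
  rw [hvmn]
  rcases lt_trichotomy (effectiveResistance c p q * unitVoltage c p q n)
    (effectiveResistance c p q * unitVoltage c p q m) with hlt | heq | hgt
  · rw [abs_of_pos (sub_pos.2 hlt)]
    linarith [levelCut_bound₁₄ hc hG hconn hpq h1 hlt]
  · rw [heq, sub_self, abs_zero, mul_zero]
    by_cases hcpq : c p q = 0
    · rw [hcpq, zero_mul, sub_zero]; exact zero_le_one
    · linarith [conductance_mul_effectiveResistance_le_one hc hG hconn hpq hcpq]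
  · rw [abs_of_neg (sub_neg.2 hgt), hc.symm m n]
    have h1' : ¬ (n = p ∧ m = q) := fun h => h2 ⟨h.2, h.1⟩
    have := levelCut_bound₁₄ hc hG hconn hpq h1' hgt
    linarith

end LevelCut

/-! ### §3. Transfer terms from effective resistances alone (polarization) -/

section Polarization

/-- `𝓡(a ↔ b) = v_a − v_b` for a transfer potential, including the degenerate pair `a = b`. [folklore] -/
private theorem resistance_eq_sub₁₄ (hc : IsConductance c) {G : SimpleGraph X}
    (hG : ∀ x y, G.Adj x y ↔ x ≠ y ∧ c x y ≠ 0) (hconn : G.Connected) {a b : X} {v : X → ℝ}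
    (hv : (Matrix.diagonal (nodeConductance c) - c) *ᵥ v = Pi.single a 1 - Pi.single b 1) :
    effectiveResistance c a b = v a - v b := by
  rcases eq_or_ne a b with rfl | hab
  · rw [effectiveResistance_self, sub_self]
  · exact effectiveResistance_eq_transferPotential_sub hc hG hconn hab hv

/-- ★ **ONE TRANSFER TERM FROM THREE RESISTANCES**: if `L u = e_a − e_b` then for every node `i`:
`u_i − u_a = ½(𝓡(i ↔ b) − 𝓡(i ↔ a) − 𝓡(a ↔ b))` (superpose the transfers `i → a` and `a → b` to
get `i → b`, then reciprocity).
[cite: SoltanMazauricZussman2014, §5 Lemma 5 (galaxy-pdf p0011 L23–L27); KirklandNeumann2012, §7.4 eq. (7.13) (`r(i,j) = l#_ii + l#_jj − 2l#_ij`, held text p0183)] -/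
theorem transferPotential_sub_source_eq (hc : IsConductance c) {G : SimpleGraph X}
    (hG : ∀ x y, G.Adj x y ↔ x ≠ y ∧ c x y ≠ 0) (hconn : G.Connected) {a b : X} {u : X → ℝ}
    (hu : (Matrix.diagonal (nodeConductance c) - c) *ᵥ u = Pi.single a 1 - Pi.single b 1) (i : X) :
    u i - u a = 1 / 2 * (effectiveResistance c i b - effectiveResistance c i a - effectiveResistance c a b) := by
  obtain ⟨w, hw⟩ := exists_transferPotential hc hG hconn i a
  have huw : (Matrix.diagonal (nodeConductance c) - c) *ᵥ (u + w) = Pi.single i 1 - Pi.single b 1 := by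
    rw [Matrix.mulVec_add, hu, hw]; abel
  have hRib := resistance_eq_sub₁₄ hc hG hconn huw
  have hRia := resistance_eq_sub₁₄ hc hG hconn hw
  have hRab := resistance_eq_sub₁₄ hc hG hconn hu
  have hrec := transferPotential_reciprocity hc hu hw
  simp only [Pi.add_apply] at hRib
  linarith

/-- ★★ **THE PTDF NUMERATOR FROM RESISTANCE DISTANCES ALONE** (polarization): if `L v = e_p − e_q`
then for all `i, j`: `v_i − v_j = ½(𝓡(i ↔ q) − 𝓡(i ↔ p) + 𝓡(j ↔ p) − 𝓡(j ↔ q))` — «`Δf_ij =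
½(−r(i,p) + r(i,q) + r(j,p) − r(j,q))/(1 − r(p,q)) f_pq`», numerator.
[cite: SoltanMazauricZussman2014, §5 Lemma 5 (galaxy-pdf p0011 L23–L27); KirklandNeumann2012, §7.4 eq. (7.13) (p0183)] -/
theorem transferPotential_sub_eq_resistances (hc : IsConductance c) {G : SimpleGraph X}
    (hG : ∀ x y, G.Adj x y ↔ x ≠ y ∧ c x y ≠ 0) (hconn : G.Connected) {p q : X} {v : X → ℝ}
    (hv : (Matrix.diagonal (nodeConductance c) - c) *ᵥ v = Pi.single p 1 - Pi.single q 1) (i j : X) :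
    v i - v j = 1 / 2 * (effectiveResistance c i q - effectiveResistance c i p
      + effectiveResistance c j p - effectiveResistance c j q) := by
  have hi := transferPotential_sub_source_eq hc hG hconn hv i
  have hj := transferPotential_sub_source_eq hc hG hconn hv j
  linarith

end Polarization

/-! ### §4. Bridges: `c(r,s)𝓡(r ↔ s) = 1` exactly when deleting the line disconnects its ends -/

section Bridge

/-- ★★★ **A LINE IS A BRIDGE IFF ITS SELF-FACTOR IS ONE** («an edge `{i,j} ∈ E` is a cut-edge if,
and only if, `a_ij⁻¹ − 2a⁺_ij + a⁺_ii + a⁺_jj = 0`» — Bapat; «`D_ll = 1` if `l` is a bridge and `0 <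
D_ll < 1` otherwise»): on a connected conductance network with graph `G`, for a line `{r,s}`:
`c(r,s)·𝓡(r ↔ s) = 1 ↔ r` and `s` are NOT joined in `G` with the edge `{r,s}` deleted; equivalently
`c(r,s)·𝓡(r ↔ s) < 1 ↔` they are.
[cite: SoltanMazauricZussman2014, §4 Lemma 1 (Bapat) (galaxy-pdf p0008 L23); GuoEtAl2020, §3.2 Corollary 5 (arXiv:2005.10199 p0008 L6–L21); KirklandNeumann2012, §7.4 Theorem 7.4.9 (p0186)] -/
theorem conductance_mul_effectiveResistance_lt_one_iff_reachable (hc : IsConductance c)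
    {G : SimpleGraph X} (hG : ∀ x y, G.Adj x y ↔ x ≠ y ∧ c x y ≠ 0) (hconn : G.Connected)
    {r s : X} (hrs : r ≠ s) (hcrs : c r s ≠ 0) :
    (c r s * effectiveResistance c r s < 1 ↔ (G.deleteEdges {s(r, s)}).Reachable r s)
    ∧ (c r s * effectiveResistance c r s = 1 ↔ ¬ (G.deleteEdges {s(r, s)}).Reachable r s) := by
  classical
  have hle := conductance_mul_effectiveResistance_le_one hc hG hconn hrs hcrs
  -- the deleted-edge graph is a graph of lines other than `{r,s}`
  have hG' : ∀ x y, (G.deleteEdges {s(r, s)}).Adj x y → c x y ≠ 0 ∧ ¬ (x = r ∧ y = s) ∧ ¬ (x = s ∧ y = r) := by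
    intro x y hxy
    rw [SimpleGraph.deleteEdges_adj, Set.mem_singleton_iff, Sym2.eq_iff] at hxy
    exact ⟨((hG x y).1 hxy.1).2, fun h => hxy.2 (Or.inl h), fun h => hxy.2 (Or.inr h)⟩
  have hfwd : (G.deleteEdges {s(r, s)}).Reachable r s → c r s * effectiveResistance c r s < 1 :=
    fun hreach => conductance_mul_effectiveResistance_lt_one hc hG hconn hrs hcrs hG' hreach
  have hbwd : ¬ (G.deleteEdges {s(r, s)}).Reachable r s → c r s * effectiveResistance c r s = 1 := by
    intro hnr
    -- the reachable set of `r` is a cut crossed only by `{r,s}`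
    set S : Finset X := Finset.univ.filter (fun x => (G.deleteEdges {s(r, s)}).Reachable r x) with hS
    have hrS : r ∈ S := by simp [hS]
    have hsS : s ∉ S := by simpa [hS] using hnr
    refine conductance_mul_effectiveResistance_eq_one_of_bridge hc hG hconn hrs hcrs S hrS hsS ?_
    intro x hx y hy hcxy
    have hxr : (G.deleteEdges {s(r, s)}).Reachable r x := by simpa [hS] using hx
    have hyr : ¬ (G.deleteEdges {s(r, s)}).Reachable r y := by simpa [hS] using hy
    have hxy : x ≠ y := fun h => hyr (h ▸ hxr)
    have hadj : G.Adj x y := (hG x y).2 ⟨hxy, hcxy⟩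
    by_cases hedge : s(x, y) = s(r, s)
    · rcases Sym2.eq_iff.1 hedge with h | h
      · exact h
      · exact absurd (h.1 ▸ hxr) (by
          intro hsr
          exact hsS (by simpa [hS] using hsr))
    · exact absurd (hxr.trans ⟨SimpleGraph.Walk.cons
        ((SimpleGraph.deleteEdges_adj).2 ⟨hadj, by rwa [Set.mem_singleton_iff]⟩) SimpleGraph.Walk.nil⟩) hyr
  refine ⟨⟨fun h => ?_, hfwd⟩, ⟨fun h hreach => ?_, hbwd⟩⟩
  · by_contra hnr
    have := hbwd hnr
    linarith
  · have := hfwd hreach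
    linarith

end Bridge

end KronReduction

/-! ### §5. THE MODEL: N−1 line outage in the DC power flow — LODF from resistance distances, and no
surviving line picks up more than the tripped line carried -/

namespace ClassicalModel

open KronReduction Literature.Probability.MarkovChains

variable {X : Type*} [Fintype X] [DecidableEq X] {c : Matrix X X ℝ}

/-- ★★★ **LODF FROM RESISTANCE DISTANCES ALONE** («`Δf_ij = ½(−r(i,p) + r(i,q) + r(j,p) −
r(j,q))/(1 − r(p,q))·f_pq`», weighted): DC power flow `L θ = P`, line `{p,q}` tripped (`L' = L −
b_pq ν_pqν_pqᵀ`, `L' θ' = P`); for every ordered pair `(i,j)`: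
`(1 − b_pq𝓡(p ↔ q))·b_ij[(θ'_i − θ'_j) − (θ_i − θ_j)] = b_ij·½(𝓡(i ↔ q) − 𝓡(i ↔ p) + 𝓡(j ↔ p) −
𝓡(j ↔ q))·b_pq(θ_p − θ_q)`.
[cite: SoltanMazauricZussman2014, §4 Corollary 1 (galaxy-pdf p0009 L21–L23), §5 Lemma 5 (p0011 L23–L27); StrakeEtAl2019, §3.2 eq. (10) (arXiv:1811.08683 p0005 L83–L88)] -/
theorem dcFlow_lineOutage_flowChange_resistances (hc : IsConductance c) {G : SimpleGraph X}
    (hG : ∀ x y, G.Adj x y ↔ x ≠ y ∧ c x y ≠ 0) (hconn : G.Connected) {p q : X} (hpq : p ≠ q)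
    {L' : Matrix X X ℝ}
    (hL' : L' = (Matrix.diagonal (nodeConductance c) - c)
        - c p q • Matrix.vecMulVec (Pi.single p (1 : ℝ) - Pi.single q 1) (Pi.single p (1 : ℝ) - Pi.single q 1))
    {P θ θ' : X → ℝ} (hθ : (Matrix.diagonal (nodeConductance c) - c) *ᵥ θ = P) (hθ' : L' *ᵥ θ' = P)
    (i j : X) :
    (1 - c p q * effectiveResistance c p q) * (c i j * ((θ' i - θ' j) - (θ i - θ j)))
      = (c i j * (1 / 2 * (effectiveResistance c i q - effectiveResistance c i p
          + effectiveResistance c j p - effectiveResistance c j q))) * (c p q * (θ p - θ q)) := by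
  obtain ⟨v, hv⟩ := exists_transferPotential hc hG hconn p q
  rw [dcFlow_lineOutage_flowChange hc hG hconn hpq hL' hθ hθ' hv i j,
    transferPotential_sub_eq_resistances hc hG hconn hv i j]

/-- ★★★ **N−1 REDISTRIBUTION BOUNDS FOR THE DC MODEL: `|LODF| ≤ 1` — NO SURVIVING LINE PICKS UP MORE
THAN THE TRIPPED LINE CARRIED — AND THE RESISTANCE-DISTANCE BOUND.**  Connected lossless grid, line
`{p,q}` (`b_pq > 0`) tripped with `p, q` still joined through other lines (any graph `G'` of lines
`≠ {p,q}` with `p, q` reachable; e.g. the damaged grid connected), `L θ = P`, `L' θ' = P`.  Then for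
every ordered pair `(m,n) ∉ {(p,q),(q,p)}`: (i) `|ΔF_{m→n}| ≤ |F_{p→q}|` (DERIVED: level-cut flow
conservation, §2); (ii) `|ΔF_{m→n}| ≤ b_mn𝓡(p ↔ q)/(1 − b_pq𝓡(p ↔ q))·|F_{p→q}|` (the weighted «`|Δf_ij|
≤ r(p,q)/(1 − r(p,q))·|f_pq|`»); (iii) the post-outage flow obeys `|F'_{m→n}| ≤ |F_{m→n}| +
|F_{p→q}|` — a certified N−1 loading screen from the pre-outage flows alone.  MODELLED: DC power
flow, fixed injections, no limits / protection; nothing is said about AC flows or dynamics.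
[cite: SoltanMazauricZussman2014, §5 Corollary 2 (galaxy-pdf p0011 L29–L31, p0012 L1); GuoEtAl2020, §3.3.1 («`K_{l l̂} = D_{l l̂}/(1 − D_{l̂ l̂})`», arXiv:2005.10199 p0008 L40–L54) with §3.2 Corollary 5; LevinPeres2017, §9.4 Lemma 9.15, §9.2 Prop. 9.1] -/
theorem dcFlow_lineOutage_flowChange_abs_le (hc : IsConductance c) {G : SimpleGraph X}
    (hG : ∀ x y, G.Adj x y ↔ x ≠ y ∧ c x y ≠ 0) (hconn : G.Connected) {p q : X} (hpq : p ≠ q)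
    (hcpq : c p q ≠ 0) {G' : SimpleGraph X}
    (hG' : ∀ x y, G'.Adj x y → c x y ≠ 0 ∧ ¬ (x = p ∧ y = q) ∧ ¬ (x = q ∧ y = p))
    (hreach : G'.Reachable p q) {L' : Matrix X X ℝ}
    (hL' : L' = (Matrix.diagonal (nodeConductance c) - c)
        - c p q • Matrix.vecMulVec (Pi.single p (1 : ℝ) - Pi.single q 1) (Pi.single p (1 : ℝ) - Pi.single q 1))
    {P θ θ' : X → ℝ} (hθ : (Matrix.diagonal (nodeConductance c) - c) *ᵥ θ = P) (hθ' : L' *ᵥ θ' = P)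
    {m n : X} (h1 : ¬ (m = p ∧ n = q)) (h2 : ¬ (m = q ∧ n = p)) :
    |c m n * ((θ' m - θ' n) - (θ m - θ n))| ≤ |c p q * (θ p - θ q)|
    ∧ |c m n * ((θ' m - θ' n) - (θ m - θ n))|
        ≤ c m n * effectiveResistance c p q / (1 - c p q * effectiveResistance c p q) * |c p q * (θ p - θ q)|
    ∧ |c m n * (θ' m - θ' n)| ≤ |c m n * (θ m - θ n)| + |c p q * (θ p - θ q)| := by
  obtain ⟨v, hv⟩ := exists_transferPotential hc hG hconn p q
  obtain ⟨hden, hdiv⟩ := dcFlow_lineOutage_flowChange_div hc hG hconn hpq hcpq hG' hreach hL' hθ hθ' hv m n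
  have hcut := conductance_mul_transferPotential_sub_le hc hG hconn hpq hv h1 h2
  have hmax := (transferPotential_mem_Icc hc hG hconn hpq hv).2.2 m n
  have hcmn : 0 ≤ c m n := hc.nonneg m n
  -- `|LODF| = c_mn|v_m − v_n|/(1 − c_pq𝓡) ≤ 1`
  have hlodf_abs : |c m n * (v m - v n) / (1 - c p q * effectiveResistance c p q)|
      = c m n * |v m - v n| / (1 - c p q * effectiveResistance c p q) := by
    rw [abs_div, abs_mul, abs_of_nonneg hcmn, abs_of_pos hden]
  have hK1 : c m n * |v m - v n| / (1 - c p q * effectiveResistance c p q) ≤ 1 := by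
    rw [div_le_one hden]; exact hcut
  have hK2 : c m n * |v m - v n| / (1 - c p q * effectiveResistance c p q)
      ≤ c m n * effectiveResistance c p q / (1 - c p q * effectiveResistance c p q) :=
    div_le_div_of_nonneg_right (mul_le_mul_of_nonneg_left hmax hcmn) hden.le
  have hΔ : |c m n * ((θ' m - θ' n) - (θ m - θ n))|
      = c m n * |v m - v n| / (1 - c p q * effectiveResistance c p q) * |c p q * (θ p - θ q)| := by
    rw [hdiv, abs_mul, hlodf_abs]
  have hF0 : 0 ≤ |c p q * (θ p - θ q)| := abs_nonneg _
  refine ⟨?_, ?_, ?_⟩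
  · rw [hΔ]; exact (mul_le_mul_of_nonneg_right hK1 hF0).trans_eq (one_mul _)
  · rw [hΔ]; exact mul_le_mul_of_nonneg_right hK2 hF0
  · have hsplit : c m n * (θ' m - θ' n) = c m n * (θ m - θ n) + c m n * ((θ' m - θ' n) - (θ m - θ n)) := by
      ring
    rw [hsplit]
    refine (abs_add_le _ _).trans ?_
    rw [hΔ]
    linarith [mul_le_mul_of_nonneg_right hK1 hF0]

end ClassicalModel

end Literature.MathematicalPhysics.PowerSystems

end
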